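import Literature.MathematicalPhysics.QuantumFieldTheory.BalabanImbrieJaffe1984to88.BIJ88Sect5StatementsPart4
import Literature.MathematicalPhysics.QuantumFieldTheory.Balaban1983to89.B1RG242

/-!
# `BalabanImbrieJaffe1984to88.BIJ88IdentityB1p296Proof` — T. Bałaban, J. Imbrie, A. Jaffe, *Effective action and cluster properties of
the abelian Higgs model*, Commun. Math. Phys. **114** (1988) 257–315 [BalabanImbrieJaffe1988]: the identity of [7] quoted on p. 296 (Sect. 5.8,
scalar field translation) — *"aL^{−2}I − a²L^{−4}Q(u_{k+1})C^{(k)}(u_{k+1})Q(u_{k+1})^* = a_kL^{−2}I − a_k²L^{−4}Q_{k+1}(u_{k+1})G^η_{k+1}(u_{k+1})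
Q_{k+1}(u_{k+1})^*"* — PROVED as a model instance on the tree's kernel-checked one-step carrier of [7] = [Balaban1982Higgs1] Sect. 2,
`Balaban1983to89.B1RG242.StepData`, where it IS the composition law of Schur complements `StepData.display221_succ`

statement-level skeleton of published theorems with citation tags; proofs where landed; nothing here is a claim about the Yang–Mills mass gap

PDF held: `paper:balaban1988-cmp114-bij-abelian-higgs-effective-action` (journal page = PDF page + 256); p. 296 [PDF 40] read this session from
the text layer (`lit read … --pages 40`; the display is garbled there and is taken from the fold owner's reading in
`BIJ88Sect5StatementsPart4.IdentityB1p296`, typed p245624 from the renders).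

WHAT IS REPRODUCED.  SKELETON row **C2.Eq5.8.1-5.8.3**, member «identity of [7], p. 296» (cell `lit-balaban`, HOME
`run/shared/lean/pub/lit-balaban/`; Phase-2 seat p02 gen 3 = unit `lit-balaban-p02`; C2 Sects. 5–end fold owner r16, referee ref-5; TAKING line
HOME/STATUS.md 2026-08-21T05:01:52Z).  Before this file the identity was the bare Prop leaf `BIJ88Sect5StatementsPart4.IdentityB1p296`.
p. 296, verbatim (owner's reading): *"We apply the identity [7] aL^{−2}I − a²L^{−4}Q(u_{k+1})C^{(k)}(u_{k+1})Q(u_{k+1})^* = a_kL^{−2}I −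
a_k²L^{−4}Q_{k+1}(u_{k+1})G^η_{k+1}(u_{k+1})Q_{k+1}(u_{k+1})^*, but in a localized version with C^{(k)}_{loc} and G^η_{k+1,loc} and with another small
kernel w″₇ on the right. This yields the desired form Δ^L_{k+1,loc}(u_{k+1})"*.  [7] = T. Bałaban, *(Higgs)₂,₃ quantum fields in a finite volume I*,
CMP **85** (1982) [Balaban1982Higgs1]: (2.13) a_{k+1} = aa_k/(aL^{−2} + a_k); (2.18)/(2.21) ⟨ψ,Δ^{(k)}ψ⟩ = a_k(L^kε)^{−2}⟨ψ,ψ⟩ −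
a_k²(L^kε)^{−4}⟨ψ,Q_kG^ε_kQ^*_kψ⟩; (2.30)/(2.31) C^{(k)} = (aL^{−2}P + Δ^{(k)})^{−1}; its kernel-checked home in the tree is `B1RG242` (r14/p34;
`StepData.display221_succ`: *"the Schur complement β·1 − β²·QC^{(k)}Q^* of the k-th step form equals γ·1 − γ²·Q_{k+1}G_{k+1}Q^*_{k+1}"*,
γ = αβ/(α + β)).

WHAT IS PROVED HERE (0 `sorry`, standard axioms; theorems only; `B1RG242` imported, nothing restated).
§1 `identityB1p296_iff` — the leaf unfolded: it is the equation `(aL⁻²)•1 − (a²L⁻⁴)•(Q·C·Qst) = (a_kL⁻²)•1 − (a_k²L⁻⁴)•(Q1·G·Q1st)` and depends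
on its six factor slots only through the two PRODUCTS (`identityB1p296_iff_of_products`).  The leaf is stated in ONE ℝ-algebra `R`; the
printed factors are rectangular (C^{(k)} acts on the k-th block lattice, Q maps it to the (k+1)-st, G^η_{k+1} acts on the fine lattice), so the
leaf is instantiated below in the corner algebra `Matrix ν ν ℝ` of the (k+1)-st block lattice with the two products entered whole.
§2 **THE IDENTITY ON [7]'s CARRIER**: `identityB1p296_step` — for `S : B1RG242.StepData ℝ ι κ ν` (H = −Δ_u (+m²) on the fine lattice, Q_k, Q^*_k,
Q, Q^*, read on BIJ's UNIT lattice: α = a_k, β = aL⁻²), under QQ^* = 1 and the invertibility of the arguments of G_k and C^{(k)}: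
`IdentityB1p296 a a′ L (Q·C^{(k)}·Q^*) 1 1 (Q_{k+1}·G_{k+1}·Q^*_{k+1}) 1 1` with **a′ = aa_k/(aL⁻² + a_k)** — [7] (2.13)'s a_{k+1} — where
`C^{(k)} = S.Ck = (aL⁻²P + Δ^{(k)})⁻¹`, `Q_{k+1} = QQ_k`, `G_{k+1} = S.Gk1 = (H + a′L⁻²P_{k+1})⁻¹` (`γ = a′L⁻²`: `gamma_unit`).
§3 `identityB1p296_aSeq` — the same with the tree's closed form a_k = `B1.aSeq a L k` = a(1 − L⁻²)/(1 − L^{−2k}) ([7] (2.15)), a′ = `B1.aSeq a L (k+1)`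
(`B1.aSeq_succ` = (2.13)); `identityB1p296_of_next` — with [7]'s Euclidean structure (`StepData.ScalarProducts`: adjoints for the weighted scalar
products (1.5), α, β > 0, H ≥ 0) the two invertibility hypotheses follow from that of G_{k+1}'s argument alone (`B1RG242.isUnit_prev_of_next`,
`isUnit_C_of_next`), and `identityB1p296_of_posDef` — from m² > 0 (H positive definite) with nothing else assumed.
READING NOTE (HOME/GAPS.md G-C2-p02-03, owner r16 to rule).  The identity FORCES the right-hand constant a′ = aa_k/(aL⁻² + a_k) = a_{k+1} of [7]
(2.13) where p. 296 prints a_k (both sides of [7] (2.18) at consecutive levels); the leaf is parametric in `(a, ak)`, so both readings type-check,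
and the proved instances carry `ak := a_{k+1}`.
HONEST SCOPE.  The "localized version with C^{(k)}_{loc} and G^η_{k+1,loc} and another small kernel w″₇" is NOT this identity but its perturbation
(statement rows (2.47)/(5.8.3)); the carrier is [7]'s finite-lattice matrix model with `QQ^* = 1` as printed there; nothing on d = 4 or the
continuum; NOT summit progress.
-/

namespace Literature.MathematicalPhysics.QuantumFieldTheory.BalabanImbrieJaffe1984to88.BIJ88IdentityB1p296Proof

open BIJ88Sect5StatementsPart4
open Literature.MathematicalPhysics.QuantumFieldTheory.Balaban1983to89
open Literature.MathematicalPhysics.QuantumFieldTheory.Balaban1983to89.B1RG242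
open Matrix

noncomputable section

/-! ## §1  The leaf unfolded -/

section Leaf

variable {R : Type*} [Ring R] [Algebra ℝ R]

/-- The leaf `IdentityB1p296` is the equation `(aL⁻²)•1 − (a²L⁻⁴)•(QCQ^*) = (a_kL⁻²)•1 − (a_k²L⁻⁴)•(Q1GQ1^*)` in the ℝ-algebra `R`.
[cite: BalabanImbrieJaffe1988, (5.8.3) p.296] -/
theorem identityB1p296_iff (a ak L : ℝ) (Q C Qst Q1 G Q1st : R) :
    IdentityB1p296 a ak L Q C Qst Q1 G Q1st ↔
      (a * L⁻¹ ^ 2) • (1 : R) - (a ^ 2 * L⁻¹ ^ 4) • (Q * C * Qst) = (ak * L⁻¹ ^ 2) • (1 : R) - (ak ^ 2 * L⁻¹ ^ 4) • (Q1 * G * Q1st) := by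
  simp only [IdentityB1p296, Algebra.algebraMap_eq_smul_one, smul_mul_assoc, one_mul]

/-- The leaf depends on its six factor slots only through the two products `Q·C·Qst` and `Q1·G·Q1st`.
[cite: BalabanImbrieJaffe1988, (5.8.3) p.296] -/
theorem identityB1p296_iff_of_products (a ak L : ℝ) {Q C Qst Q1 G Q1st X Y : R} (hX : Q * C * Qst = X) (hY : Q1 * G * Q1st = Y) :
    IdentityB1p296 a ak L Q C Qst Q1 G Q1st ↔ IdentityB1p296 a ak L X 1 1 Y 1 1 := by
  rw [identityB1p296_iff, identityB1p296_iff, hX, hY, mul_one, mul_one, mul_one, mul_one]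

end Leaf

/-! ## §2  The identity on [7]'s one-step carrier `B1RG242.StepData` -/

section Step

variable {ι κ ν : Type*} [Fintype ι] [Fintype κ] [Fintype ν] [DecidableEq ι] [DecidableEq κ] [DecidableEq ν]
variable (S : StepData ℝ ι κ ν)

omit [Fintype ι] [Fintype κ] [Fintype ν] [DecidableEq ι] [DecidableEq κ] [DecidableEq ν] in
/-- BIJ's unit-lattice constants: with α = a_k and β = aL⁻², [7]'s γ = αβ/(α + β) is a′L⁻² with a′ = aa_k/(aL⁻² + a_k) ((2.13): a′ = a_{k+1}).
[cite: Balaban1982Higgs1, (2.13) p.609] -/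
theorem gamma_unit {a ak L : ℝ} (ha : 0 < a) (hak : 0 < ak) (hL : 0 < L) (hα : S.α = ak) (hβ : S.β = a * L⁻¹ ^ 2) :
    S.γ = a * ak / (a * (L ^ 2)⁻¹ + ak) * L⁻¹ ^ 2 := by
  have h1 : a * (L ^ 2)⁻¹ + ak ≠ 0 := by positivity
  have h2 : ak + a * L⁻¹ ^ 2 ≠ 0 := by positivity
  rw [StepData.γ, hα, hβ]
  field_simp
  ring

/-- **THE IDENTITY OF [7] QUOTED ON p. 296, PROVED** («model instance» on `B1RG242.StepData`, BIJ's unit lattice: α = a_k, β = aL⁻²): under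
QQ^* = 1 and the invertibility of the arguments of G_k = (H + a_kP_k)⁻¹ and C^{(k)} = (aL⁻²P + Δ^{(k)})⁻¹, the leaf holds in the corner algebra
`Matrix ν ν ℝ` of the (k+1)-st block lattice with the printed products `Q·C^{(k)}·Q^*` and `Q_{k+1}·G_{k+1}·Q^*_{k+1}` (`Q_{k+1} = QQ_k`,
`G_{k+1} = (H + a′L⁻²P_{k+1})⁻¹`) and the right-hand constant **a′ = aa_k/(aL⁻² + a_k)** = a_{k+1} of [7] (2.13): it IS `StepData.display221_succ`.
[cite: BalabanImbrieJaffe1988, (5.8.3) p.296] -/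
theorem identityB1p296_step {a ak L : ℝ} (ha : 0 < a) (hak : 0 < ak) (hL : 0 < L) (hα : S.α = ak) (hβ : S.β = a * L⁻¹ ^ 2)
    (hQ : S.Q * S.Qs = 1) (hG : IsUnit (S.H + S.α • S.Pk)) (hC : IsUnit (S.β • S.P + S.Δk)) :
    IdentityB1p296 a (a * ak / (a * (L ^ 2)⁻¹ + ak)) L (S.Q * S.Ck * S.Qs) 1 1 (S.Qk1 * S.Gk1 * S.Qk1s) 1 1 := by
  have hαβ : S.α + S.β ≠ 0 := by rw [hα, hβ]; positivity
  have h := S.display221_succ hQ hαβ hG hC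
  rw [gamma_unit S ha hak hL hα hβ, hβ] at h
  rw [identityB1p296_iff, mul_one, mul_one, mul_one, mul_one]
  convert h using 3 <;> ring

end Step

/-! ## §3  With the closed form a_k of [7] (2.15), and with [7]'s Euclidean structure -/

section Printed

variable {ι κ ν : Type*} [Fintype ι] [Fintype κ] [Fintype ν] [DecidableEq ι] [DecidableEq κ] [DecidableEq ν]
variable (S : StepData ℝ ι κ ν)

/-- The identity with a_k = `B1.aSeq a L k` = a(1 − L⁻²)/(1 − L^{−2k}) inside Δ^{(k)}, C^{(k)} and **a_{k+1} = `B1.aSeq a L (k+1)`** on the right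
(`B1.aSeq_succ` = [7] (2.13)). [cite: BalabanImbrieJaffe1988, (5.8.3) p.296] -/
theorem identityB1p296_aSeq {a L : ℝ} {k : ℕ} (ha : 0 < a) (hL : 1 < L) (hk : 1 ≤ k) (hα : S.α = B1.aSeq a L k)
    (hβ : S.β = a * L⁻¹ ^ 2) (hQ : S.Q * S.Qs = 1) (hG : IsUnit (S.H + S.α • S.Pk)) (hC : IsUnit (S.β • S.P + S.Δk)) :
    IdentityB1p296 a (B1.aSeq a L (k + 1)) L (S.Q * S.Ck * S.Qs) 1 1 (S.Qk1 * S.Gk1 * S.Qk1s) 1 1 := by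
  rw [B1.aSeq_succ ha hL hk]
  exact identityB1p296_step S ha (B1.aSeq_pos ha hL hk) (lt_trans one_pos hL) hα hβ hQ hG hC

variable {S} {WE : Matrix ι ι ℝ} {WK : Matrix κ κ ℝ} {WM : Matrix ν ν ℝ}

/-- With [7]'s Euclidean structure (1.5) (`StepData.ScalarProducts`: Q^*_k, Q^* the adjoints for the weighted scalar products, α, β > 0,
H = −Δ_u + m² ≥ 0) the invertibility of the arguments of G_k and C^{(k)} follows from that of G_{k+1}'s argument (`B1RG242.isUnit_prev_of_next`,
`isUnit_C_of_next` — [7] p. 611 *"It is so"*). [cite: BalabanImbrieJaffe1988, (5.8.3) p.296] -/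
theorem identityB1p296_of_next (E : S.ScalarProducts WE WK WM) {a ak L : ℝ} (ha : 0 < a) (hL : 0 < L) (hα : S.α = ak)
    (hβ : S.β = a * L⁻¹ ^ 2) (hQ : S.Q * S.Qs = 1) (hnext : IsUnit (S.H + S.γ • S.Pk1)) :
    IdentityB1p296 a (a * ak / (a * (L ^ 2)⁻¹ + ak)) L (S.Q * S.Ck * S.Qs) 1 1 (S.Qk1 * S.Gk1 * S.Qk1s) 1 1 :=
  identityB1p296_step S ha (hα ▸ E.α_pos) hL hα hβ hQ (StepData.isUnit_prev_of_next E hnext) (StepData.isUnit_C_of_next E hnext)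

/-- With m² > 0 (H positive definite for the fine scalar product) nothing needs to be assumed beyond [7]'s Euclidean structure and QQ^* = 1
(`B1RG242.StepData.display242_of_posDef`). [cite: BalabanImbrieJaffe1988, (5.8.3) p.296] -/
theorem identityB1p296_of_posDef (E : S.ScalarProducts WE WK WM) {a ak L : ℝ} (ha : 0 < a) (hL : 0 < L) (hα : S.α = ak)
    (hβ : S.β = a * L⁻¹ ^ 2) (hQ : S.Q * S.Qs = 1) (hH : ∀ φ, φ ≠ 0 → 0 < φ ⬝ᵥ (WE *ᵥ (S.H *ᵥ φ))) :
    IdentityB1p296 a (a * ak / (a * (L ^ 2)⁻¹ + ak)) L (S.Q * S.Ck * S.Qs) 1 1 (S.Qk1 * S.Gk1 * S.Qk1s) 1 1 :=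
  identityB1p296_of_next E ha hL hα hβ hQ (StepData.display242_of_posDef E hQ hH).1

end Printed

end

end Literature.MathematicalPhysics.QuantumFieldTheory.BalabanImbrieJaffe1984to88.BIJ88IdentityB1p296Proof
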